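import Mathlib.LinearAlgebra.Dimension.Finrank
import Mathlib.LinearAlgebra.FiniteDimensional.Defs
import Mathlib.LinearAlgebra.FiniteDimensional.Lemmas
import Mathlib.LinearAlgebra.Quotient.Basic
import Mathlib.LinearAlgebra.Prod
import Mathlib.Data.ZMod.Basic
import Mathlib.Tactic.Linarith
import Mathlib.Tactic.NormNum
import Mathlib.Tactic.FinCases
import HarnessLib

/-!
# The (0,1) cell of the ι-window, EXISTENCE side, XXVII: the Zariski tangent space of `{rank B ≤ 8}` at a nodal half-pair has
# dimension 3 — skeleton of `H2-EXISTENCE-SIDE-27.md` (prover 3 gen 34)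

Family `hodge`, b2b cell `hweil`, `Summits/HodgeConjecture/HodgeConjecture/Theorems` (helper of item stmt-HodgeConjecture-2524).
New topic, new file.

Setting as in [XVI]–[XXVI]: `(A, Θ)` a general ppav fourfold with a ramified presentation `π : C̃ → C` (genus 4, two branch points),
`Z_n = ψ(C̃)` the nodal carrier, `Λ_x = H⁰(𝓘_{S_x}(2Θ)) = ⟨κ(x), ∂₁κ(x), …, ∂₄κ(x)⟩ ⊂ H⁰(2Θ) ≅ ℂ¹⁶`, `B(x, x′) = [Λ_x | Λ_{x′}]`
(16 × 10), `kdim = 10 − rank B`, and `𝒩` the 3-dimensional family of nodal half-pairs `(a, a′) = ((u+w)/2, (w−u)/2)`, `u, w ∈ Z_n`,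
on which `rank B = 8` ([XXIV] THEOREM FH, [XXV]/[XXVI] `kdim = 2` exactly).  The report proves THEOREM DM3: at the general nodal
half-pair the Zariski tangent space of `M₈ = {rank B ≤ 8}` has dimension EXACTLY 3, so `M₈` is smooth there and coincides with the
closure of `𝒩` near that point ([XXIII] (F1) 'dim M-II = 3', until now MEASURED in floating point).  The proof: (1) over the locus
`rank B = 8` the determinantal scheme is isomorphic to the incidence `{(p, K) : B(p)K = 0}` (K a 10 × 2 kernel matrix in a chart), whose
tangent space is the kernel of a 32 × 24 Jacobian `J = [D | I₂ ⊗ B_F]` with `B_F` (16 × 8) injective; (2) the LINEAR-ALGEBRA LEMMA of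
this file: `ker [D | Y] ≅ ker (q ∘ D)` for `Y` injective and `q` the quotient by `range Y` — so `dim T = 8 − rank L` with `L = (I₂ ⊗ Q)D`
the 16 × 8 'second-order system' of [XXVI] 5.2; (3) lower semicontinuity of `rank L` on the irreducible family of (cover, pair) and
`dim T ≥ 3` along `𝒩`; (4) ONE CERTIFIED INSTANCE `rank L ≥ 5`: the explicit two-branch-point cover `C5 : y⁵ = x(x²−1)(x²−4)²`,
`σ(x,y) = (−x,−y)`, whose Prym, Abel–Prym images and second-order theta data are computed in BALL ARITHMETIC (Arb via python-flint:
rigorous integration, FLINT's `acb_theta` jets) on an exactly computed symplectic homology of the Prym (kit job of record j134562,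
second pair j134563, 192-bit; history j134495 / j134532 / j134533: every certificate inequality is a ball excluding zero; `rank B ≤ 8`
at that cover is THEOREM FH, whose open hypotheses are among the certified inequalities).
HONEST FRAMING: this file kernel-checks (a) the linear-algebra lemma of step (2) in full generality (any division ring), with the
numerical corollary `8 − 5 = 3` in its invariant form, and (b) the finite bookkeeping of the explicit cover `C5` (genus and
Riemann–Hurwitz counts, the holomorphic-differential table, the parity rule for anti-invariance, the exact branch directions, the
injectivity criterion for `Sym² H⁰(ω⁻) → H⁰(ω²)` that distinguishes `C5` (rank 10, fibre of the Prym map of dimension 1) from the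
first candidate `C3 : y³ = x²∏(x²−j²)` (rank 9, fibre dimension 2, tangent dimension 4), the rotation-number argument for
'C = C5/σ is not hyperelliptic', and the sizes 32 × 24, 24 − 21 = 3).  The certified computation itself is NOT re-run in the kernel
(its certificate is attached to the item as compute evidence); the analytic geometry (Pryms, theta functions, semicontinuity on
`ℛ_{4,2}`) is NOT kernel-checked.  Census result about one cell of the ladder's H2 test on the existence side; no case of the Hodge
conjecture is proved; nothing here is a rung; no statement of [Markman 2025] is used.  0 unconditional rungs above the floor.
-/

set_option linter.dupNamespace false

namespace Summit.HodgeConjecture.HodgeConjecture.WeilTypeLadder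

section H2TangentDimensionXXVII

/-! ### (a) The linear-algebra lemma behind `dim T = 8 − rank L` -/

/-- KERNEL OF A BLOCK MAP WITH AN INJECTIVE BLOCK (report 3.2, step (2)): for linear maps `D : V₁ → W` and `Y : V₂ → W` with `Y`
injective, projection to the first factor is a linear ISOMORPHISM from `ker (D ⊕ Y : V₁ × V₂ → W)` onto `ker (q ∘ D)`, `q : W → W ⧸ range Y`.
(Applied with `V₁ = T_pA² ≅ ℂ⁸` (the unknowns `(ȧ, ȧ′)`), `V₂ = ℂ¹⁶` (the unknowns `K̇′`), `W = ℂ³²`, `Y = I₂ ⊗ B_F`, `D = ∂(BK)/∂p`: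
the Zariski tangent space of the incidence scheme is `ker [D | Y]`, and `q ∘ D` is the second-order system `L`.) -/
theorem ker_coprod_equiv_of_injective {K : Type*} [DivisionRing K] {V₁ V₂ W : Type*} [AddCommGroup V₁] [Module K V₁]
    [AddCommGroup V₂] [Module K V₂] [AddCommGroup W] [Module K W] (D : V₁ →ₗ[K] W) (Y : V₂ →ₗ[K] W)
    (hY : LinearMap.ker Y = ⊥) :
    Nonempty (LinearMap.ker (D.coprod Y) ≃ₗ[K] LinearMap.ker ((LinearMap.range Y).mkQ ∘ₗ D)) := by
  have hinj : Function.Injective Y := LinearMap.ker_eq_bot.mp hY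
  -- membership facts
  have mem1 : ∀ v : V₁ × V₂, v ∈ LinearMap.ker (D.coprod Y) ↔ D v.1 + Y v.2 = 0 := by
    intro v
    rw [LinearMap.mem_ker, LinearMap.coprod_apply]
  have mem2 : ∀ x : V₁, x ∈ LinearMap.ker ((LinearMap.range Y).mkQ ∘ₗ D) ↔ ∃ y : V₂, Y y = D x := by
    intro x
    rw [LinearMap.mem_ker, LinearMap.comp_apply, Submodule.mkQ_apply, Submodule.Quotient.mk_eq_zero, LinearMap.mem_range]
  let φ : LinearMap.ker (D.coprod Y) →ₗ[K] LinearMap.ker ((LinearMap.range Y).mkQ ∘ₗ D) :=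
    { toFun := fun v => ⟨(v : V₁ × V₂).1, by
        have hv := (mem1 v).mp v.2
        rw [mem2]
        exact ⟨-(v : V₁ × V₂).2, by rw [map_neg]; exact (eq_neg_of_add_eq_zero_left hv).symm⟩⟩
      map_add' := fun v w => by ext; rfl
      map_smul' := fun c v => by ext; rfl }
  refine ⟨LinearEquiv.ofBijective φ ⟨?_, ?_⟩⟩
  · intro v w h
    have h1 : (v : V₁ × V₂).1 = (w : V₁ × V₂).1 := by
      have := congrArg (fun z : LinearMap.ker ((LinearMap.range Y).mkQ ∘ₗ D) => (z : V₁)) h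
      exact this
    have hv := (mem1 v).mp v.2
    have hw := (mem1 w).mp w.2
    have h2 : (v : V₁ × V₂).2 = (w : V₁ × V₂).2 := by
      apply hinj
      have ev : Y (v : V₁ × V₂).2 = -D (v : V₁ × V₂).1 := eq_neg_of_add_eq_zero_right hv
      have ew : Y (w : V₁ × V₂).2 = -D (w : V₁ × V₂).1 := eq_neg_of_add_eq_zero_right hw
      rw [ev, ew, h1]
    exact Subtype.ext (Prod.ext h1 h2)
  · intro u
    obtain ⟨y, hy⟩ := (mem2 u).mp u.2
    refine ⟨⟨((u : V₁), -y), (mem1 _).mpr ?_⟩, ?_⟩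
    · simp only [map_neg, hy, add_neg_cancel]
    · exact Subtype.ext rfl

/-- Hence the DIMENSIONS agree (finite-dimensional case): `dim ker [D | Y] = dim ker (q ∘ D)`. -/
theorem finrank_ker_coprod_of_injective {K : Type*} [DivisionRing K] {V₁ V₂ W : Type*} [AddCommGroup V₁] [Module K V₁]
    [AddCommGroup V₂] [Module K V₂] [AddCommGroup W] [Module K W] (D : V₁ →ₗ[K] W) (Y : V₂ →ₗ[K] W)
    (hY : LinearMap.ker Y = ⊥) :
    Module.finrank K (LinearMap.ker (D.coprod Y)) = Module.finrank K (LinearMap.ker ((LinearMap.range Y).mkQ ∘ₗ D)) :=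
  (ker_coprod_equiv_of_injective D Y hY).some.finrank_eq

/-- THE TANGENT-DIMENSION COUNT IN INVARIANT FORM (report 3.2–3.3): if the `p`-unknowns form an 8-dimensional space and the
second-order system `L = q ∘ D` has rank 5, then the tangent space `ker [D | Y]` of the incidence scheme is 3-dimensional. -/
theorem tangent_space_dim_three {K : Type*} [DivisionRing K] {V₁ V₂ W : Type*} [AddCommGroup V₁] [Module K V₁]
    [AddCommGroup V₂] [Module K V₂] [AddCommGroup W] [Module K W] [FiniteDimensional K V₁]
    (D : V₁ →ₗ[K] W) (Y : V₂ →ₗ[K] W) (hY : LinearMap.ker Y = ⊥)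
    (h8 : Module.finrank K V₁ = 8)
    (hL : Module.finrank K (LinearMap.range ((LinearMap.range Y).mkQ ∘ₗ D)) = 5) :
    Module.finrank K (LinearMap.ker (D.coprod Y)) = 3 := by
  rw [finrank_ker_coprod_of_injective D Y hY]
  have h := LinearMap.finrank_range_add_finrank_ker ((LinearMap.range Y).mkQ ∘ₗ D)
  omega

/-- The general form of the same count: `dim ker [D | Y] = dim V₁ − rank (q ∘ D)`; with a CERTIFIED LOWER bound `rank L ≥ r` one gets
the UPPER bound `dim T ≤ dim V₁ − r` (report 3.3: `r = 5`, `dim V₁ = 8`, `dim T ≤ 3`; the opposite inequality is `dim 𝒩 = 3`). -/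
theorem tangent_space_dim_le {K : Type*} [DivisionRing K] {V₁ V₂ W : Type*} [AddCommGroup V₁] [Module K V₁]
    [AddCommGroup V₂] [Module K V₂] [AddCommGroup W] [Module K W] [FiniteDimensional K V₁]
    (D : V₁ →ₗ[K] W) (Y : V₂ →ₗ[K] W) (hY : LinearMap.ker Y = ⊥) (n r : ℕ)
    (hn : Module.finrank K V₁ = n) (hL : r ≤ Module.finrank K (LinearMap.range ((LinearMap.range Y).mkQ ∘ₗ D))) :
    Module.finrank K (LinearMap.ker (D.coprod Y)) ≤ n - r := by
  rw [finrank_ker_coprod_of_injective D Y hY]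
  have h := LinearMap.finrank_range_add_finrank_ker ((LinearMap.range Y).mkQ ∘ₗ D)
  omega

/-! ### (b) Bookkeeping of the explicit cover `C5 : y⁵ = x(x² − 1)(x² − 4)²`, `σ(x,y) = (−x,−y)` -/

/-- SIZES (report 3.1–3.3): the incidence equations `B(p)K = 0` are `16·2 = 32` scalar equations in `8 + 8·2 = 24` unknowns
(`p = (a, a′) ∈ ℂ⁸`, `K′ ∈ ℂ^{8×2}`); `rank J = rank(I₂ ⊗ B_F) + rank L = 2·8 + 5 = 21`; `dim T = 24 − 21 = 3 = 8 − 5`; the expected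
dimension of `{rank ≤ 8}` in the 8-dimensional pair space is `8 − (16 − 8)·(10 − 8) = −8`, that of `{rank ≤ 9}` is `8 − 7 = 1`. -/
theorem incidence_sizes :
    16 * 2 = 32 ∧ 8 + 8 * 2 = 24 ∧ 2 * 8 + 5 = 21 ∧ 24 - 21 = 3 ∧ 8 - 5 = 3 ∧
    (8 : ℤ) - (16 - 8) * (10 - 8) = -8 ∧ (8 : ℤ) - (16 - 9) * (10 - 9) = 1 := by
  norm_num

/-- GENUS AND PRYM NUMBERS OF `C5` (report 2.1): a cyclic cover `y^m = h` of `ℙ¹` totally ramified over `N` points has genus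
`(m−1)(N−2)/2`; `C5` (`m = 5`; branch points `0, ±1, ±2` and `∞`, the last because `deg h = 1 + 2 + 4 = 7` is prime to 5) has genus
`4·4/2 = 8`; the involution `σ` has exactly the two fixed points over `0` and `∞`, so by Riemann–Hurwitz `2·8 − 2 = 2(2·4 − 2) + 2`
the quotient `C = C5/σ` has genus 4 (it is the cyclic quintic cover of `ℙ¹` branched at the 4 points `0, 1, 4, ∞`:
`4·2/2 = 4`), and the Prym `P(C5/C)` has dimension `8 − 4 = 4` with `rank H₁⁻ = 2·4 = 8` and a polarisation of type `(2,2,2,2)`,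
i.e. `E|_{H₁⁻} = 2·Ξ` with `Ξ` principal (two branch points).  The first candidate `C3 : y³ = x²(x²−1)(x²−4)(x²−9)(x²−16)` has
`m = 3`, 10 branch points (`deg = 10` prime to 3), genus `2·8/2 = 8` as well. -/
theorem C5_genus_and_prym_numbers :
    (1 + 2 + 4) % 5 ≠ 0 ∧ (5 - 1) * (6 - 2) / 2 = 8 ∧ 2 * 8 - 2 = 2 * (2 * 4 - 2) + 2 ∧ (5 - 1) * (4 - 2) / 2 = 4 ∧
    8 - 4 = 4 ∧ 2 * 4 = 8 ∧ 16 - 8 = 8 ∧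
    (2 + 8) % 3 ≠ 0 ∧ (3 - 1) * (10 - 2) / 2 = 8 := by
  norm_num

/-- THE HOLOMORPHIC DIFFERENTIALS OF `C5` (report 2.2): a form `x^a (x²−4)^c dx / y^b` (`1 ≤ b ≤ 4`, `c ∈ {0,1}`) is holomorphic iff
(i) at the simple branch points `0, ±1` (`x − r = w⁵`, `y ∼ w`): `4 − b ≥ 0`; (ii) at `±2` (exponent 2, `y ∼ w²`): `5c + 4 ≥ 2b`;
(iii) at `∞` (`x = w⁻⁵`, `y ∼ w⁻⁷`): `7b ≥ 5a + 10c + 6`.  The eight listed triples `(a,b,c)` satisfy (i)–(iii) (they are the basis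
used; `g = 8`), and `σ^*` acts on such a form by `(−1)^{a+1+b}` (`x ↦ −x`, `dx ↦ −dx`, `y ↦ −y`, `x² − 4` fixed), so the
ANTI-INVARIANT ones are exactly the four with `a + b` even: `dx/y²`, `x(x²−4)dx/y³`, `(x²−4)dx/y⁴`, `x²(x²−4)dx/y⁴` (`dim P = 4`). -/
theorem C5_differentials :
    (∀ t ∈ [(0,1,0), (0,2,0), (1,2,0), (0,3,1), (1,3,1), (0,4,1), (1,4,1), (2,4,1)],
      (fun (p : ℕ × ℕ × ℕ) => 1 ≤ p.2.1 ∧ p.2.1 ≤ 4 ∧ 2 * p.2.1 ≤ 5 * p.2.2 + 4 ∧ 5 * p.1 + 10 * p.2.2 + 6 ≤ 7 * p.2.1) t) ∧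
    [(0,1,0), (0,2,0), (1,2,0), (0,3,1), (1,3,1), (0,4,1), (1,4,1), (2,4,1)].length = 8 ∧
    ([(0,1,0), (0,2,0), (1,2,0), (0,3,1), (1,3,1), (0,4,1), (1,4,1), (2,4,1)].filter
      (fun (p : ℕ × ℕ × ℕ) => (p.1 + p.2.1) % 2 == 0)) = [(0,2,0), (1,3,1), (0,4,1), (2,4,1)] := by
  refine ⟨?_, by decide, by decide⟩
  decide

/-- THE BRANCH DIRECTIONS ARE EXACT BASIS COVECTORS (report 2.4): at the ramification point `R₁` over `x = 0` (uniformiser `x = w⁵`,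
`y ∼ w`) the form `x^a (x²−4)^c dx/y^b` vanishes to order `5a + 4 − b`, which is `0` only for `(a,b) = (0,4)` (and then needs
`c = 1` and `(−4)^c ≠ 0`): among the four anti-invariant forms only `(x²−4)dx/y⁴` is non-zero at `R₁`.  At `R₂` over `∞` (`x = w⁻⁵`,
`y ∼ w⁻⁷`) the order is `7b − 5a − 10c − 6`, zero only for `x(x²−4)dx/y³` among the four.  So `b₁ ∝ e₃`, `b₂ ∝ e₂` in the basis
`(η₁,…,η₄) = (dx/y², x(x²−4)dx/y³, (x²−4)dx/y⁴, x²(x²−4)dx/y⁴)` of `H⁰(ω⁻)^∨`-coordinates: distinct, non-zero (certificate C5). -/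
theorem C5_branch_directions :
    ([(0,2,0), (1,3,1), (0,4,1), (2,4,1)].map (fun (p : ℕ × ℕ × ℕ) => 5 * p.1 + 4 - p.2.1) = [2, 6, 0, 10]) ∧
    ([(0,2,0), (1,3,1), (0,4,1), (2,4,1)].map (fun (p : ℕ × ℕ × ℕ) => 7 * p.2.1 - 5 * p.1 - 10 * p.2.2 - 6) = [8, 0, 12, 2]) := by
  decide

/-- THE PRYM MAP IS IMMERSIVE AT `C5` BUT NOT AT `C3` (report 2.5): the differential of `𝒫 : ℛ_{4,2} → 𝒜₄` at a cover is dual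
to the multiplication map `μ⁻ : Sym² H⁰(ω⁻) → H⁰(ω_{C̃}²)` (`dim Sym² = 4·5/2 = 10 = dim 𝒜₄`; `dim ℛ_{4,2} = 3·4 − 3 + 2 = 11`),
and `dim ker d𝒫 = 11 − rank μ⁻`.  For `C5` the ten products `η_iη_j` are `x^{a}(x²−4)^{c}(dx)²/y^{b}` with the listed `(a,b,c)`;
within each `b` they have pairwise distinct degrees `a + 2c`, hence are linearly independent: `rank μ⁻ = 10`, fibre dimension
`11 − 10 = 1`, tangent dimension `2 + 1 = 3`.  For `C3` (`η = dx/y, x²dx/y, x²dx/y², x⁴dx/y²`, i.e. `(a,b) = (0,1),(2,1),(2,2),(4,2)`)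
the products `η₁η₄` and `η₂η₃` are both `x⁴(dx)²/y³`: `rank μ⁻ = 9`, fibre dimension `2`, tangent dimension `2 + 2 = 4` — exactly
what the floating-point pipeline measured at the two covers (`σ₆(L) ≈ 10⁻¹⁵` resp. `σ₅(L) ≈ 10⁻¹⁵`). -/
theorem prym_map_rank_at_C5_and_C3 :
    4 * 5 / 2 = 10 ∧ 3 * 4 - 3 + 2 = 11 ∧ 11 - 10 = 1 ∧ 11 - 9 = 2 ∧ 2 + 1 = 3 ∧ 2 + 2 = 4 ∧
    -- C5: the 10 products as (a, b, c); pairwise distinct (b, a + 2c)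
    (([(0,4,0), (1,5,1), (0,6,1), (2,6,1), (2,6,2), (1,7,2), (3,7,2), (0,8,2), (2,8,2), (4,8,2)].map
      (fun (p : ℕ × ℕ × ℕ) => (p.2.1, p.1 + 2 * p.2.2))).Nodup) ∧
    -- C3: the products (a + a', b + b') of (0,1),(2,1),(2,2),(4,2): a repeated value
    ¬ ([(0,2), (2,2), (2,3), (4,3), (4,2), (4,3), (6,3), (4,4), (6,4), (8,4)] : List (ℕ × ℕ)).Nodup := by
  refine ⟨by norm_num, by norm_num, by norm_num, by norm_num, by norm_num, by norm_num, by decide, by decide⟩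

/-- `C = C5/σ` IS NOT HYPERELLIPTIC (report 2.1 (d)): `C` is the cyclic quintic cover `v⁵ = t³(t−1)(t−4)²` of `ℙ¹_t` (`t = x²`,
`v = xy`), totally ramified at `t = 0, 1, 4, ∞` with exponents `(3, 1, 2, 4)` (`∞`: `−(3+1+2) ≡ 4`); its rotation numbers are the
inverses mod 5, `(2, 1, 3, 4)` — four DISTINCT units.  A hyperelliptic genus-4 curve with an automorphism of order 5 is
`y² = x¹⁰ + αx⁵ + β`, whose rotation numbers at its four fixed points are `(j, j, −j, −j)` — never four distinct values.  Since the
rotation type is an invariant of the `ℤ/5`-curve up to `j ↦ kj` (`k` a unit), `C` is not hyperelliptic (so `(G2)` holds at `C5`;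
not needed for the certificate, recorded for the census). -/
theorem C5_quotient_not_hyperelliptic :
    (3 * 2) % 5 = 1 ∧ (1 * 1) % 5 = 1 ∧ (2 * 3) % 5 = 1 ∧ (4 * 4) % 5 = 1 ∧ (3 + 1 + 2 + 4) % 5 = 0 ∧
    (∀ k : ZMod 5, k ≠ 0 → ([2 * k, 1 * k, 3 * k, 4 * k] : List (ZMod 5)).Nodup) ∧
    (∀ j : ZMod 5, ¬ ([j, j, -j, -j] : List (ZMod 5)).Nodup) := by
  refine ⟨by norm_num, by norm_num, by norm_num, by norm_num, by norm_num, by decide, by decide⟩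

/-- THE SEMICONTINUITY BOOKKEEPING (report 3.4): the parameter space of (cover, ordered pair of points) has dimension
`11 + 2 = 13`; the rank of the 16 × 8 matrix `L` is at most `8 − 3 = 5` along `𝒩` (because `dim 𝒩 = 1 + 2 = 3` for a general
fourfold: one-dimensional fibres of `𝒫_{4,2}`, [FNS21]) and lower semicontinuous; one point with `rank L ≥ 5` therefore gives
`rank L = 5`, `dim T = 3`, on a dense open subset.  At the certified point the relevant minors have certified absolute lower bounds
(job j134562: `|det₈(B)| ≥ 0.27`, `|det₅(L/‖L‖_max)| ≥ 0.10`; second pair j134563: `0.058`, `0.22`) — positive numbers, which is all the argument uses. -/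
theorem semicontinuity_bookkeeping (rankL dimT : ℕ) (h_sum : rankL + dimT = 8) (h_lower : 5 ≤ rankL) (h_N : 3 ≤ dimT) :
    rankL = 5 ∧ dimT = 3 ∧ 11 + 2 = 13 ∧ 1 + 2 = 3 := by
  omega

end H2TangentDimensionXXVII

end Summit.HodgeConjecture.HodgeConjecture.WeilTypeLadder
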